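import Summits.QuantumFields.YangMills.Theorems.BalabanUVNodesK2AtBetaOfRecord13ChainFree
import Summits.QuantumFields.BalabanUV.Gaps.EndTopRunFadingMemory

/-!
# DAG node N26 ∕ crux K2 — K2's CONSEQUENT AT THE CORE DATUM OF RECORD AS AN **EQUIVALENT** β-SIDE STATEMENT: «no backsliding from the top» for the in-interval runs of the
# Stage-13 β of record (the gaps cell's top-run criterion `Gaps.EndRunwiseHeadline.endpointExistence_datum_iff_topRuns` keyed at `Node00.datumOfRecord₁₃Core θ hc`), under N26's
# B4 + the printed upper bound (U) + non-crossing; with the third modelling clause `HaltsOutside` DISCHARGED at the record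

Cell `pub-ymgap`, YM-PLAN Track A (HUMAN RULING D-0062), seat `pub-ymgap-dag-n26-c` gen 9 (R134 acceleration seat, s2); helper for crux K2⁗ `EndpointGivenBR13Sep` (stmt-QuantumFields-20291;
rev-20 successor K2⁵ by token map).  COMPANION of this lineage's `…K2AtBetaOfRecord13ChainFree` (p509259: K2's consequent from five chain-free currencies) and `…N26AtRecord13Core` (p510090:
the Core-keyed faces): there every road is ONE-WAY; here the gaps cell's TWO-WAY criterion (seat g1-p3 gen 6, `Gaps/EndTopRunCriterion` ∕ `EndRunwiseHeadline`) is keyed at the record —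
for a datum whose construction HALTS OUTSIDE (modelling clause 3 of `FlowStepRuns`) and whose β is jointly continuous, `≤ β'` and NON-CROSSING on the in-interval runs at every small
level, `EndpointExistence D.C.toB12` is EQUIVALENT to «for every small level γ some `g⋆ > 0` bounds from below the endpoint of every in-interval run of (0.20) that sits at γ».  At NODE
00's records the construction is `T4DatumAssembly.RGMachineCore.construction` over the Core tower, for which `HaltsOutside` is a THEOREM (`RGMachineCore.haltsOutside`), so at the
record the clause is discharged and the equivalence costs only B4 + (U) + non-crossing.

WHAT IS HERE (0 `def`, 0 `sorry`; every proof `rfl`-level or ONE application of a landed theorem):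
* §0 `haltsOutside_datumOfRecord₁₃Core` — `HaltsOutside (datumOfRecord₁₃Core F N θ hc).C.toB12 (betaOfRecord₁₃ F N θ)` (the core `coreOfRecord₁₃ θ` over the Core tower; `rfl`-level),
  and its Sep-datum form `haltsOutside_datumOfRecord₁₃Sep`.
* §1 ★ `endpointExistence_datumOfRecord₁₃Core_iff_topRuns (hc) (hγ₀) (hβ') (hcont : BetaContH γ₀ (betaOfRecord₁₃ F N θ)) (hhi : BetaUpperH β' γ₀ …) (hord)` — K2's consequent at the
  Core datum ⟺ the top-run condition; `endpointExistence_datumOfRecord₁₃Sep_iff_topRuns` (the v1.2 item edition's datum, `hc := hP.toCore`).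
* §2 `endpointExistence_datumOfRecord₁₃Core_iff_topRuns_merged` — the same with B4 and (U) READ ON THE MERGED β `β_m` on the box (`γ₀ ≤ θ.γ`; p509259 §0 + p491248
  `betaContH_betaOfRecord₁₃_iff`).
* §3 `hord_betaOfRecord₁₃_of_cooperative_lastLipschitz_merged` — the NON-CROSSING hypothesis itself SUPPLIED from two sentences about `β_m` on the box: cooperativity in the past
  couplings and a Lipschitz constant `M` in the last coupling with `M·γ₀³ < 2` (gaps cell R-33 `Gaps.EndTopRunFadingMemory.hord_of_cooperative_lastLipschitz`, [I] §5 p.298's weak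
  dependence on the preceding couplings); ★ `endpointExistence_datumOfRecord₁₃Core_iff_topRuns_allMerged` — the equivalence with EVERY hypothesis a sentence about `β_m` on `]0,γ₀]^{k+1}`
  (continuity, `≤ β'`, cooperativity, last-coupling Lipschitz).

HONEST FRAMING.  An EQUIVALENCE between displayed predicates at the record, kernel-checked; NEITHER side is proved; B4, (U) and the non-crossing of the runs are HYPOTHESES on the
record's β proved nowhere (instance 0∕1 for Bałaban's objects); nothing of Bałaban's analysis asserted; K2⁗ ∕ `stub_d1Residue13` ∕ `stub_d4AtSlopeCont13` NOT proved; N25 ∕ N26 NOT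
discharged (N26 VACATED ∕ (D4)-dependent; counts unmoved 5∕27 · A 5∕28); general `N`; one finite four-torus programme at fixed ε per run — NOT the continuum limit, NOT ℝ⁴, NOT OS,
NOT a mass gap, NOT Clay.  No `instance`, no `notation`, no `axiom`.
Sources (context): [I] = [Balaban1987RG1] CMP **109** (1987): Thm 2 p. 259 (first sentence; proof unpublished, [Balaban1989LargeFieldII] p. 355), (0.18)–(0.20) pp. 255–256,
(0.31) p. 259, (1.20)–(1.22) p. 264.
-/

noncomputable section

open scoped Matrix.Norms.L2Operator

namespace Summit.QuantumFields.YangMills.Theorems.BalabanUVNodesK2AtRecord13CoreTopRuns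

open Literature.MathematicalPhysics.QuantumFieldTheory.Balaban1983to89
open Literature.MathematicalPhysics.QuantumFieldTheory.Balaban1983to89.FlowStep
open Literature.MathematicalPhysics.QuantumFieldTheory.Balaban1983to89.FlowStepRuns (HaltsOutside)
open Literature.MathematicalPhysics.QuantumFieldTheory.Balaban1983to89.DagBinding (EndpointExistence)
open Literature.MathematicalPhysics.QuantumFieldTheory.Balaban1983to89.T4Continuum (T4Family FiniteEpsData)
open Literature.MathematicalPhysics.QuantumFieldTheory.Balaban1983to89.T4DatumAssembly
open Literature.MathematicalPhysics.QuantumFieldTheory.Balaban1983to89.Node00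
open Summit.QuantumFields.BalabanUV.Gaps.EndRunwiseHeadline (endpointExistence_datum_iff_topRuns)
open Summit.QuantumFields.BalabanUV.Gaps.EndTopRunFadingMemory (hord_of_cooperative_lastLipschitz)
open Summit.QuantumFields.YangMills.Theorems.BalabanUVNodesK2AtBetaOfRecord13ChainFree (betaOfRecord₁₃_apply_of_mem_box)
open Summit.QuantumFields.YangMills.Theorems.BalabanUVNodesN26AtRecord13 (betaContH_betaOfRecord₁₃_iff)
open Summit.QuantumFields.YangMills.Theorems.BalabanUVNodesK2AtBetaOfRecord13ChainFree (betaUpperH_betaOfRecord₁₃_iff)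
open Filter Topology

variable (F : T4Family) (N : ℕ) [NeZero N]

/-! ## §0 The third modelling clause `HaltsOutside` is a THEOREM at the records -/

section Halts

variable (θ : Stage13Params F N)

/-- **`HaltsOutside` AT THE CORE DATUM OF RECORD**: once `1∕g_k² − β_{k+1}(g_0,…,g_k) ≤ 0` along a positive prefix, the next coupling of the run is `≤ 0` — the construction of record
is `RGMachineCore.construction` over the Core tower (`datumOfTower`, `rfl`), whose couplings are `genSeq` with the `solveCoupling` convention (`RGMachineCore.haltsOutside`).
[cite: Balaban1987RG1, (0.18)–(0.20) pp.255–256 (bookkeeping: the coupling recursion of record)] -/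
theorem haltsOutside_datumOfRecord₁₃Core (hc : θ.Provisos₁₃Core F N) :
    HaltsOutside (datumOfRecord₁₃Core F N θ hc).C.toB12 (betaOfRecord₁₃ F N θ) :=
  (coreOfRecord₁₃ F N θ).haltsOutside (towerOfRecord₁₃Core F N θ hc).ρ

/-- … and at the separated-range (v1.2) item edition's datum (`datumOfRecord₁₃Sep_eq_core`, `rfl`). [cite: Balaban1987RG1, (0.18)–(0.20) pp.255–256 (bookkeeping)] -/
theorem haltsOutside_datumOfRecord₁₃Sep (hP : θ.Provisos₁₃Sep F N) :
    HaltsOutside (datumOfRecord₁₃Sep F N θ hP).C.toB12 (betaOfRecord₁₃ F N θ) :=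
  haltsOutside_datumOfRecord₁₃Core F N θ hP.toCore

end Halts

/-! ## §1 K2's consequent at the Core datum ⟺ «no backsliding from the top» -/

section TopRuns

variable (θ : Stage13Params F N)

/-- **★ K2's CONSEQUENT AT THE CORE DATUM OF RECORD IS EQUIVALENT TO THE TOP-RUN CONDITION** (gaps cell g1-p3's criterion `Gaps.EndRunwiseHeadline.endpointExistence_datum_iff_topRuns` at
`datumOfRecord₁₃Core θ hc`, with `HaltsOutside` DISCHARGED by §0): given N26's B4 on `]0,γ₀]` and the printed upper bound (U) there for `betaOfRecord₁₃ F N θ`, and non-crossing of the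
in-interval runs of (0.20) at every level `γ ≤ γ₀`, `EndpointExistence (datumOfRecord₁₃Core F N θ hc).C.toB12 ↔ ∃ γ₂ > 0, ∀ γ ∈ ]0,γ₂], ∃ g⋆ > 0, every in-interval (]0,γ]) solution of
(0.20) that sits at γ at a step k ≤ n has g_n ≥ g⋆`.  Neither side proved; B4 ∕ (U) ∕ non-crossing are hypotheses (instance 0∕1). [cite: Balaban1987RG1, Thm 2 p.259 (first sentence) and (0.20) p.256] -/
theorem endpointExistence_datumOfRecord₁₃Core_iff_topRuns (hc : θ.Provisos₁₃Core F N) {γ₀ β' : ℝ} (hγ₀ : 0 < γ₀) (hβ' : 0 ≤ β')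
    (hcont : BetaContH γ₀ (betaOfRecord₁₃ F N θ)) (hhi : BetaUpperH β' γ₀ (betaOfRecord₁₃ F N θ))
    (hord : ∀ γ : ℝ, 0 < γ → γ ≤ γ₀ → ∀ (n : ℕ) (gs gs' : ℕ → ℝ), RGEqH n (betaOfRecord₁₃ F N θ) gs → RGEqH n (betaOfRecord₁₃ F N θ) gs' →
      Step.InInterval γ n gs → Step.InInterval γ n gs' → gs 0 < gs' 0 → ∀ k, k ≤ n → gs k < gs' k) :
    EndpointExistence (datumOfRecord₁₃Core F N θ hc).C.toB12 ↔
      ∃ γ₂ : ℝ, 0 < γ₂ ∧ ∀ γ : ℝ, 0 < γ → γ ≤ γ₂ → ∃ gstar : ℝ, 0 < gstar ∧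
        ∀ (n : ℕ) (gs : ℕ → ℝ), RGEqH n (betaOfRecord₁₃ F N θ) gs → Step.InInterval γ n gs → ∀ k, k ≤ n → gs k = γ → gstar ≤ gs n :=
  endpointExistence_datum_iff_topRuns (datumOfRecord₁₃Core F N θ hc) (haltsOutside_datumOfRecord₁₃Core F N θ hc) hγ₀ hβ' hcont hhi hord

/-- **The same at the separated-range (v1.2) item edition's datum** `datumOfRecord₁₃Sep θ hP` (`hc := hP.toCore`; every later edition repeats this line with its own `.toCore`).
[cite: Balaban1987RG1, Thm 2 p.259 (first sentence) and (0.20) p.256] -/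
theorem endpointExistence_datumOfRecord₁₃Sep_iff_topRuns (hP : θ.Provisos₁₃Sep F N) {γ₀ β' : ℝ} (hγ₀ : 0 < γ₀) (hβ' : 0 ≤ β')
    (hcont : BetaContH γ₀ (betaOfRecord₁₃ F N θ)) (hhi : BetaUpperH β' γ₀ (betaOfRecord₁₃ F N θ))
    (hord : ∀ γ : ℝ, 0 < γ → γ ≤ γ₀ → ∀ (n : ℕ) (gs gs' : ℕ → ℝ), RGEqH n (betaOfRecord₁₃ F N θ) gs → RGEqH n (betaOfRecord₁₃ F N θ) gs' →
      Step.InInterval γ n gs → Step.InInterval γ n gs' → gs 0 < gs' 0 → ∀ k, k ≤ n → gs k < gs' k) :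
    EndpointExistence (datumOfRecord₁₃Sep F N θ hP).C.toB12 ↔
      ∃ γ₂ : ℝ, 0 < γ₂ ∧ ∀ γ : ℝ, 0 < γ → γ ≤ γ₂ → ∃ gstar : ℝ, 0 < gstar ∧
        ∀ (n : ℕ) (gs : ℕ → ℝ), RGEqH n (betaOfRecord₁₃ F N θ) gs → Step.InInterval γ n gs → ∀ k, k ≤ n → gs k = γ → gstar ≤ gs n :=
  endpointExistence_datumOfRecord₁₃Core_iff_topRuns F N θ hP.toCore hγ₀ hβ' hcont hhi hord

end TopRuns

/-! ## §2 B4 and (U) read on the merged β -/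

section Merged

variable (θ : Stage13Params F N)

/-- **The top-run equivalence with B4 and (U) READ ON THE MERGED β** `β_m = betaMerged F (mergedTermFamilyMatT F N (TcanOfRecord F N) (chiFixed29 F N θ.ν θ.ε₂₉) θ.εbg) θ.ρ8 θ.bV` on
`]0,γ₀]^{k+1}` (`0 < γ₀ ≤ θ.γ`: there the β of record IS `β_m`): per-`k` `ContinuousOn (β_m k) (Box γ₀ k)` and `β_m ≤ β'` on the box, plus non-crossing of the runs of the β of record ⟹
(`EndpointExistence` at the Core datum ⟺ the top-run condition).  Instance 0∕1. [cite: Balaban1987RG1, Thm 2 p.259 (first sentence), (0.31) p.259 and (1.20)–(1.22) p.264] -/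
theorem endpointExistence_datumOfRecord₁₃Core_iff_topRuns_merged (hc : θ.Provisos₁₃Core F N) {γ₀ β' : ℝ} (hγ₀ : 0 < γ₀) (hle : γ₀ ≤ θ.γ) (hβ' : 0 ≤ β')
    (hcont : letI := θ.instVβ₁; letI := θ.instVβ₂; letI := θ.instιβ
      ∀ k, ContinuousOn (betaMerged F (mergedTermFamilyMatT F N (TcanOfRecord F N) (chiFixed29 F N θ.ν θ.ε₂₉) θ.εbg) θ.ρ8 θ.bV k) (Box γ₀ k))
    (hhi : letI := θ.instVβ₁; letI := θ.instVβ₂; letI := θ.instιβ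
      ∀ k (v : Fin (k + 1) → ℝ), v ∈ Box γ₀ k →
        betaMerged F (mergedTermFamilyMatT F N (TcanOfRecord F N) (chiFixed29 F N θ.ν θ.ε₂₉) θ.εbg) θ.ρ8 θ.bV k v ≤ β')
    (hord : ∀ γ : ℝ, 0 < γ → γ ≤ γ₀ → ∀ (n : ℕ) (gs gs' : ℕ → ℝ), RGEqH n (betaOfRecord₁₃ F N θ) gs → RGEqH n (betaOfRecord₁₃ F N θ) gs' →
      Step.InInterval γ n gs → Step.InInterval γ n gs' → gs 0 < gs' 0 → ∀ k, k ≤ n → gs k < gs' k) :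
    EndpointExistence (datumOfRecord₁₃Core F N θ hc).C.toB12 ↔
      ∃ γ₂ : ℝ, 0 < γ₂ ∧ ∀ γ : ℝ, 0 < γ → γ ≤ γ₂ → ∃ gstar : ℝ, 0 < gstar ∧
        ∀ (n : ℕ) (gs : ℕ → ℝ), RGEqH n (betaOfRecord₁₃ F N θ) gs → Step.InInterval γ n gs → ∀ k, k ≤ n → gs k = γ → gstar ≤ gs n :=
  endpointExistence_datumOfRecord₁₃Core_iff_topRuns F N θ hc hγ₀ hβ' ((betaContH_betaOfRecord₁₃_iff F N θ hle).2 hcont)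
    ((betaUpperH_betaOfRecord₁₃_iff F N θ hle β').2 hhi) hord

end Merged

/-! ## §3 Non-crossing supplied from cooperativity + last-coupling Lipschitz, read on the merged β; the all-merged equivalence -/

section AllMerged

variable (θ : Stage13Params F N)

/-- **NON-CROSSING OF THE IN-INTERVAL RUNS OF THE β OF RECORD FROM TWO SENTENCES ABOUT `β_m` ON THE BOX** `]0,γ₀]^{k+1}` (`0 < γ₀ ≤ θ.γ`): cooperativity in the past couplings (at fixed last
coupling, `β_m k` is monotone in the earlier entries) and a Lipschitz constant `M ≥ 0` in the last coupling with `M·γ₀³ < 2` (`Gaps.EndTopRunFadingMemory.hord_of_cooperative_lastLipschitz`,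
the (D)-road's Markov threshold with «Markov» replaced by «cooperative»; on the box the β of record IS `β_m`).  Hypothesis shapes of printed TYPE ([I] §5 p.298: β_j «depends also on all
preceding coupling constants», weakly); proved nowhere for Bałaban's objects. [cite: Balaban1987RG1, (0.20) p.256, §1 p.263 and §5 p.298] -/
theorem hord_betaOfRecord₁₃_of_cooperative_lastLipschitz_merged {γ₀ M : ℝ} (hγ₀ : 0 < γ₀) (hle : γ₀ ≤ θ.γ)
    (hcoop : letI := θ.instVβ₁; letI := θ.instVβ₂; letI := θ.instιβ
      ∀ (k : ℕ) (v v' : Fin (k + 1) → ℝ), v ∈ Box γ₀ k → v' ∈ Box γ₀ k → (∀ i, v i ≤ v' i) → v (Fin.last k) = v' (Fin.last k) →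
        betaMerged F (mergedTermFamilyMatT F N (TcanOfRecord F N) (chiFixed29 F N θ.ν θ.ε₂₉) θ.εbg) θ.ρ8 θ.bV k v ≤
          betaMerged F (mergedTermFamilyMatT F N (TcanOfRecord F N) (chiFixed29 F N θ.ν θ.ε₂₉) θ.εbg) θ.ρ8 θ.bV k v')
    (hlast : letI := θ.instVβ₁; letI := θ.instVβ₂; letI := θ.instιβ
      ∀ (k : ℕ) (v : Fin (k + 1) → ℝ), v ∈ Box γ₀ k → ∀ x y : ℝ, 0 < x → x ≤ γ₀ → 0 < y → y ≤ γ₀ →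
        |betaMerged F (mergedTermFamilyMatT F N (TcanOfRecord F N) (chiFixed29 F N θ.ν θ.ε₂₉) θ.εbg) θ.ρ8 θ.bV k (Function.update v (Fin.last k) x) -
            betaMerged F (mergedTermFamilyMatT F N (TcanOfRecord F N) (chiFixed29 F N θ.ν θ.ε₂₉) θ.εbg) θ.ρ8 θ.bV k (Function.update v (Fin.last k) y)| ≤ M * |x - y|)
    (hM : 0 ≤ M) (hsmall : M * γ₀ ^ 3 < 2) :
    ∀ γ : ℝ, 0 < γ → γ ≤ γ₀ → ∀ (n : ℕ) (gs gs' : ℕ → ℝ), RGEqH n (betaOfRecord₁₃ F N θ) gs → RGEqH n (betaOfRecord₁₃ F N θ) gs' →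
      Step.InInterval γ n gs → Step.InInterval γ n gs' → gs 0 < gs' 0 → ∀ k, k ≤ n → gs k < gs' k := by
  have hupd : ∀ (k : ℕ) (v : Fin (k + 1) → ℝ), v ∈ Box γ₀ k → ∀ x : ℝ, 0 < x → x ≤ γ₀ → Function.update v (Fin.last k) x ∈ Box γ₀ k := by
    intro k v hv x hx hxγ
    refine mem_box.mpr fun i => ?_
    by_cases hi : i = Fin.last k
    · subst hi; simp [hx, hxγ]
    · rw [Function.update_of_ne hi]; exact (mem_box.mp hv) i
  refine hord_of_cooperative_lastLipschitz hγ₀ (fun k v v' hv hv' hvv' hlastEq => ?_) (fun k v hv x y hx hxγ hy hyγ => ?_) hM hsmall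
  · rw [betaOfRecord₁₃_apply_of_mem_box F N θ hle hv, betaOfRecord₁₃_apply_of_mem_box F N θ hle hv']
    exact hcoop k v v' hv hv' hvv' hlastEq
  · rw [betaOfRecord₁₃_apply_of_mem_box F N θ hle (hupd k v hv x hx hxγ), betaOfRecord₁₃_apply_of_mem_box F N θ hle (hupd k v hv y hy hyγ)]
    exact hlast k v hv x y hx hxγ hy hyγ

/-- **★ K2's CONSEQUENT AT THE CORE DATUM ⟺ THE TOP-RUN CONDITION, WITH EVERY HYPOTHESIS A SENTENCE ABOUT THE MERGED β ON `]0,γ₀]^{k+1}`** (`0 < γ₀ ≤ θ.γ`): per-`k` continuity, the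
upper bound `β_m ≤ β'`, cooperativity in the past couplings, and last-coupling Lipschitz `M` with `M·γ₀³ < 2` ⟹ (`EndpointExistence (datumOfRecord₁₃Core F N θ hc).C.toB12` ⟺ «no
backsliding from the top»).  Neither side proved; the four sentences are hypotheses (instance 0∕1). [cite: Balaban1987RG1, Thm 2 p.259 (first sentence), (0.20) p.256, (0.31) p.259, (1.20)–(1.22) p.264 and §5 p.298] -/
theorem endpointExistence_datumOfRecord₁₃Core_iff_topRuns_allMerged (hc : θ.Provisos₁₃Core F N) {γ₀ β' M : ℝ} (hγ₀ : 0 < γ₀) (hle : γ₀ ≤ θ.γ) (hβ' : 0 ≤ β')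
    (hcont : letI := θ.instVβ₁; letI := θ.instVβ₂; letI := θ.instιβ
      ∀ k, ContinuousOn (betaMerged F (mergedTermFamilyMatT F N (TcanOfRecord F N) (chiFixed29 F N θ.ν θ.ε₂₉) θ.εbg) θ.ρ8 θ.bV k) (Box γ₀ k))
    (hhi : letI := θ.instVβ₁; letI := θ.instVβ₂; letI := θ.instιβ
      ∀ k (v : Fin (k + 1) → ℝ), v ∈ Box γ₀ k →
        betaMerged F (mergedTermFamilyMatT F N (TcanOfRecord F N) (chiFixed29 F N θ.ν θ.ε₂₉) θ.εbg) θ.ρ8 θ.bV k v ≤ β')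
    (hcoop : letI := θ.instVβ₁; letI := θ.instVβ₂; letI := θ.instιβ
      ∀ (k : ℕ) (v v' : Fin (k + 1) → ℝ), v ∈ Box γ₀ k → v' ∈ Box γ₀ k → (∀ i, v i ≤ v' i) → v (Fin.last k) = v' (Fin.last k) →
        betaMerged F (mergedTermFamilyMatT F N (TcanOfRecord F N) (chiFixed29 F N θ.ν θ.ε₂₉) θ.εbg) θ.ρ8 θ.bV k v ≤
          betaMerged F (mergedTermFamilyMatT F N (TcanOfRecord F N) (chiFixed29 F N θ.ν θ.ε₂₉) θ.εbg) θ.ρ8 θ.bV k v')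
    (hlast : letI := θ.instVβ₁; letI := θ.instVβ₂; letI := θ.instιβ
      ∀ (k : ℕ) (v : Fin (k + 1) → ℝ), v ∈ Box γ₀ k → ∀ x y : ℝ, 0 < x → x ≤ γ₀ → 0 < y → y ≤ γ₀ →
        |betaMerged F (mergedTermFamilyMatT F N (TcanOfRecord F N) (chiFixed29 F N θ.ν θ.ε₂₉) θ.εbg) θ.ρ8 θ.bV k (Function.update v (Fin.last k) x) -
            betaMerged F (mergedTermFamilyMatT F N (TcanOfRecord F N) (chiFixed29 F N θ.ν θ.ε₂₉) θ.εbg) θ.ρ8 θ.bV k (Function.update v (Fin.last k) y)| ≤ M * |x - y|)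
    (hM : 0 ≤ M) (hsmall : M * γ₀ ^ 3 < 2) :
    EndpointExistence (datumOfRecord₁₃Core F N θ hc).C.toB12 ↔
      ∃ γ₂ : ℝ, 0 < γ₂ ∧ ∀ γ : ℝ, 0 < γ → γ ≤ γ₂ → ∃ gstar : ℝ, 0 < gstar ∧
        ∀ (n : ℕ) (gs : ℕ → ℝ), RGEqH n (betaOfRecord₁₃ F N θ) gs → Step.InInterval γ n gs → ∀ k, k ≤ n → gs k = γ → gstar ≤ gs n :=
  endpointExistence_datumOfRecord₁₃Core_iff_topRuns_merged F N θ hc hγ₀ hle hβ' hcont hhi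
    (hord_betaOfRecord₁₃_of_cooperative_lastLipschitz_merged F N θ hγ₀ hle hcoop hlast hM hsmall)

end AllMerged

end Summit.QuantumFields.YangMills.Theorems.BalabanUVNodesK2AtRecord13CoreTopRuns

end
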